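import Summits.HubbardSuperconductivity.HubbardSuperconductivity.Theorems.AnisotropyChordTransferFibre3RowCXSTail

/-!
# Route `AnisotropyChord` / H0 rotor rung, row C (KT-2b): the WINDOW majorant of the summand of `XSn` — objects and factor brackets

Continuation of `…RowCXSPointwise`/`…RowCXSTail`.  For an integer point `p` such that `p` and `p − x̂` lie in the punctured
window `zWindow K` (`4K ≤ L`), any `T ≥ θ²` (`θ = 2π/L`) with `T ≤ 1` and any cell `0 ≤ ν₁ ≤ ν ≤ ν₂ < 4/π²` on which the
window denominators are positive, the exact form `s = e·G₋²(1 − dG) − d²(a_y − ν)G²G₋²` (`sN_eq`) is bounded factorwise: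
`G ∈ [1/(|q|² − ν₁), 1/(W_T(q) − ν₂)]` (`Xf_lower`, `Xf_window` at `θ₀ = θ`, `W_T` decreasing in `T`),
`|d| = 4 sin(θm/2) sin(θ/2)/θ² ∈ [m(1 − Tm²/24)(1 − T/24), m]`, `m = |2pₓ − 1|`, `sign d = sign(2pₓ − 1)`
(`Real.cos_sub_cos`, `Real.sin_le`, `Real.sin_ge_sub_cube`), `a_y ∈ [p_y²(1 − Tp_y²/12), p_y²]` (`sq_sub_quartic_le`),
`0 ≤ e ≤ 1`.  THIS FILE: the explicit real majorant `sHiR = Ghi(p−x̂)²·FA + FB` (`winT`, `GloR`, `GhiR`, `mR`, `dloR`,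
`ayloR`, `FAR`, `FBR`; a rational function of `(T, ν₁, ν₂, p)`, evaluated in `ℚ` per cell by `…RowCXSBracket`), the factor
bracket `Xf_bracket`, the sine-product bracket `sin_prod_bracket`, and the four elementary term inequalities; the assembly
★ `sN_window_le : s(toTor p) ≤ sHiR T ν₁ ν₂ p` is `…RowCXSWindow`.
Prover seat `hubbard-h0-rotor-p1` g28 (route lead); helper for piece A = stmt-HubbardSuperconductivity-23918 of rung 19089
(`--supports`, helper class).  WHAT THIS IS NOT: nothing here proves superconductivity in the Hubbard model; a pointwise lemma
for one input of ONE row of ONE conditional reduction; the rotor TARGET as originally worded stays FALSE (g15 verdict).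
Tree imports only; no sorry, no new axioms.
-/

set_option linter.dupNamespace false
set_option autoImplicit false

noncomputable section

open scoped BigOperators
open Complex

namespace Summit.HubbardSuperconductivity.HubbardSuperconductivity.Theorems.AnisotropyChord.Transfer.Fibre3

namespace RowC

open B1

variable (L : ℕ) [NeZero L]

/-! ## The real majorant -/

/-- the window energy with `θ₀²` replaced by a parameter `T`: `W_T(q) = q₁²(1 − Tq₁²/12) + q₂²(1 − Tq₂²/12)`
(`= winE θ₀ q` at `T = θ₀²`, decreasing in `T`). -/
def winT (T : ℝ) (q : ℤ × ℤ) : ℝ :=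
  ((q.1 : ℤ) : ℝ) ^ 2 * (1 - T * ((q.1 : ℤ) : ℝ) ^ 2 / 12) + ((q.2 : ℤ) : ℝ) ^ 2 * (1 - T * ((q.2 : ℤ) : ℝ) ^ 2 / 12)

/-- lower factor bracket `1/(|q|² − ν₁)`. -/
def GloR (ν₁ : ℝ) (q : ℤ × ℤ) : ℝ := 1 / (nsq q - ν₁)

/-- upper factor bracket `1/(W_T(q) − ν₂)`. -/
def GhiR (T ν₂ : ℝ) (q : ℤ × ℤ) : ℝ := 1 / (winT T q - ν₂)

/-- `m = |2pₓ − 1|` (upper bracket of `|d|`). -/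
def mR (p : ℤ × ℤ) : ℝ := |2 * ((p.1 : ℤ) : ℝ) - 1|

/-- lower bracket of `|d|`: `max 0 (m(1 − Tm²/24)(1 − T/24))`. -/
def dloR (T : ℝ) (p : ℤ × ℤ) : ℝ := max 0 (mR p * (1 - T * mR p ^ 2 / 24) * (1 - T / 24))

/-- lower bracket of `a_y`: `p_y²(1 − Tp_y²/12)`. -/
def ayloR (T : ℝ) (p : ℤ × ℤ) : ℝ := ((p.2 : ℤ) : ℝ) ^ 2 * (1 - T * ((p.2 : ℤ) : ℝ) ^ 2 / 12)

/-- the shifted point `p − x̂`. -/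
def shx (p : ℤ × ℤ) : ℤ × ℤ := p + ((-1 : ℤ), (0 : ℤ))

/-- majorant of the factor `(1 − dG)` (cases on the sign of `d`). -/
def FAR (T ν₁ ν₂ : ℝ) (p : ℤ × ℤ) : ℝ :=
  if 1 ≤ p.1 then max 0 (1 - dloR T p * GloR ν₁ p) else 1 + mR p * GhiR T ν₂ p

/-- majorant of `−d²(a_y − ν)G²G₋²` (cases on the sign of `a_y^lo − ν₂`). -/
def FBR (T ν₁ ν₂ : ℝ) (p : ℤ × ℤ) : ℝ :=
  if 0 ≤ ayloR T p - ν₂ then -(dloR T p ^ 2 * (ayloR T p - ν₂) * GloR ν₁ p ^ 2 * GloR ν₁ (shx p) ^ 2)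
  else mR p ^ 2 * (ν₂ - ayloR T p) * GhiR T ν₂ p ^ 2 * GhiR T ν₂ (shx p) ^ 2

/-- ★ the window majorant `sHiR = Ghi(p − x̂)²·FA + FB`. -/
def sHiR (T ν₁ ν₂ : ℝ) (p : ℤ × ℤ) : ℝ := GhiR T ν₂ (shx p) ^ 2 * FAR T ν₁ ν₂ p + FBR T ν₁ ν₂ p

/-! ## Factor brackets -/

omit [NeZero L] in
/-- `W_T(q) ≤ winE θ q` for `θ² ≤ T`. [folklore] -/
theorem winT_le_winE (T θ : ℝ) (hT : θ ^ 2 ≤ T) (q : ℤ × ℤ) : winT T q ≤ winE θ q := by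
  unfold winT winE
  have h1 : 0 ≤ ((q.1 : ℤ) : ℝ) ^ 2 := sq_nonneg _
  have h2 : 0 ≤ ((q.2 : ℤ) : ℝ) ^ 2 := sq_nonneg _
  nlinarith [mul_nonneg h1 h1, mul_nonneg h2 h2]

/-- the two-sided bracket of a window factor on a cell: `GloR ν₁ q ≤ X_t(k) ≤ GhiR T ν₂ q` when `k + t` lifts to `q ∈ zWindow K`,
`4K ≤ L`, `θ² ≤ T`, `ν₁ ≤ ν ≤ ν₂ < 4/π²`, `0 < W_T(q) − ν₂`. [folklore] -/
theorem Xf_bracket (K : ℕ) (h4K : 4 * K ≤ L) (T ν₁ ν₂ ν : ℝ) (hT : (2 * Real.pi / L) ^ 2 ≤ T) (h1 : ν₁ ≤ ν) (h2 : ν ≤ ν₂)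
    (hν : ν < 4 / Real.pi ^ 2) (t : ℤ × ℤ) (k : Tor L) (q : ℤ × ℤ) (hq : q ∈ zWindow K) (h : k + toTor L t = toTor L q)
    (hpos : 0 < winT T q - ν₂) :
    GloR ν₁ q ≤ Xf L ν t k ∧ Xf L ν t k ≤ GhiR T ν₂ q ∧ 0 ≤ GloR ν₁ q := by
  have hLpos : (0 : ℝ) < L := by exact_mod_cast Nat.pos_of_ne_zero (NeZero.ne L)
  have hθK := theta_mul_le L K h4K
  have hq0 : q ≠ (0, 0) := ((mem_zWindow_iff K q).1 hq).1
  have hns : (1 : ℝ) ≤ nsq q := one_le_sq_add_sq _ _ hq0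
  have hpi3 := Real.pi_gt_three
  have hν1' : ν < 1 := lt_of_lt_of_le hν (by rw [div_le_one (by positivity)]; nlinarith)
  have hlo := Xf_lower L ν hν K h4K t k q hq h
  have hhi := Xf_window L ν hν (2 * Real.pi / L) K le_rfl hθK t k q hq h
  refine ⟨?_, ?_, ?_⟩
  · refine le_trans ?_ hlo
    unfold GloR
    exact one_div_le_one_div_of_le (by linarith) (by linarith)
  · refine hhi.trans ?_
    unfold GhiR
    apply one_div_le_one_div_of_le hpos
    have := winT_le_winE T (2 * Real.pi / L) hT q
    linarith
  · unfold GloR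
    exact div_nonneg zero_le_one (by linarith)

/-- `0 ≤ aₓ`-type weights at integer points: `aₓ(toTor p) = 2(1 − cos(θp₁))/θ²`. [folklore] -/
theorem ax_toTor (p : ℤ × ℤ) :
    ax L (toTor L p) = 2 * (1 - Real.cos (2 * Real.pi / L * ((p.1 : ℤ) : ℝ))) / (2 * Real.pi / L) ^ 2 := by
  unfold ax toTor
  rw [phase_ex_re]
  simp only
  rw [cos_two_pi_val_intCast]
  congr 3
  ring

/-- `a_y(toTor p) = 2(1 − cos(θp₂))/θ²`. [folklore] -/
theorem ay_toTor (p : ℤ × ℤ) :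
    ay L (toTor L p) = 2 * (1 - Real.cos (2 * Real.pi / L * ((p.2 : ℤ) : ℝ))) / (2 * Real.pi / L) ^ 2 := by
  unfold ay toTor
  rw [phase_ey_re]
  simp only
  rw [cos_two_pi_val_intCast]
  congr 3
  ring

/-- `toTor (p − x̂) = toTor p − K₁`. [folklore] -/
theorem toTor_shx (p : ℤ × ℤ) : toTor L (shx p) = toTor L p - K1 L := by
  unfold shx
  rw [toTor_add, toTor_neg_one_zero, sub_eq_add_neg]

/-- the product form of `d` at an integer point: `d = 4 sin(θ(p₁ − ½)) sin(θ/2)/θ²`. [folklore] -/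
theorem d_toTor (p : ℤ × ℤ) :
    ax L (toTor L p) - ax L (toTor L p - K1 L)
      = 4 * Real.sin (2 * Real.pi / L * (((p.1 : ℤ) : ℝ) - 1 / 2)) * Real.sin (2 * Real.pi / L / 2)
          / (2 * Real.pi / L) ^ 2 := by
  rw [← toTor_shx, ax_toTor, ax_toTor]
  unfold shx
  simp only [Prod.fst_add, Int.cast_add, Int.cast_neg, Int.cast_one]
  set θ : ℝ := 2 * Real.pi / L
  have hc := Real.cos_sub_cos (θ * (((p.1 : ℤ) : ℝ) + -1)) (θ * ((p.1 : ℤ) : ℝ))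
  have e1 : (θ * (((p.1 : ℤ) : ℝ) + -1) + θ * ((p.1 : ℤ) : ℝ)) / 2 = θ * (((p.1 : ℤ) : ℝ) - 1 / 2) := by ring
  have e2 : (θ * (((p.1 : ℤ) : ℝ) + -1) - θ * ((p.1 : ℤ) : ℝ)) / 2 = -(θ / 2) := by ring
  rw [e1, e2, Real.sin_neg] at hc
  have : 2 * (1 - Real.cos (θ * ((p.1 : ℤ) : ℝ))) / θ ^ 2 - 2 * (1 - Real.cos (θ * (((p.1 : ℤ) : ℝ) + -1))) / θ ^ 2
      = 2 * (Real.cos (θ * (((p.1 : ℤ) : ℝ) + -1)) - Real.cos (θ * ((p.1 : ℤ) : ℝ))) / θ ^ 2 := by ring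
  rw [this, hc]
  ring

omit [NeZero L] in
/-- the sine product bracket: for `0 ≤ x`, `0 < θ`, `θ² ≤ T ≤ 1`, `x² θ² ≤ 6`:
`x(1 − Tx²/6)(1 − T/24) ≤ 4 sin(θx) sin(θ/2)/θ² ≤ 2x`... stated with `m = 2x`:
`max 0 (m(1 − Tm²/24)(1 − T/24)) ≤ 4 sin(θm/2) sin(θ/2)/θ² ≤ m`. [folklore] -/
theorem sin_prod_bracket (θ T m : ℝ) (hθ : 0 < θ) (hT : θ ^ 2 ≤ T) (hT1 : T ≤ 1) (hm : 0 ≤ m) (hmθ : (θ * (m / 2)) ^ 2 ≤ 6) :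
    max 0 (m * (1 - T * m ^ 2 / 24) * (1 - T / 24)) ≤ 4 * Real.sin (θ * (m / 2)) * Real.sin (θ / 2) / θ ^ 2 ∧
      4 * Real.sin (θ * (m / 2)) * Real.sin (θ / 2) / θ ^ 2 ≤ m := by
  have hy0 : 0 ≤ θ * (m / 2) := by positivity
  have hh0 : 0 ≤ θ / 2 := by positivity
  have s1u : Real.sin (θ * (m / 2)) ≤ θ * (m / 2) := Real.sin_le hy0
  have s1l : θ * (m / 2) - (θ * (m / 2)) ^ 3 / 6 ≤ Real.sin (θ * (m / 2)) := Real.sin_ge_sub_cube hy0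
  have s2u : Real.sin (θ / 2) ≤ θ / 2 := Real.sin_le hh0
  have s2l : θ / 2 - (θ / 2) ^ 3 / 6 ≤ Real.sin (θ / 2) := Real.sin_ge_sub_cube hh0
  have hs1 : 0 ≤ Real.sin (θ * (m / 2)) := by
    have : 0 ≤ θ * (m / 2) - (θ * (m / 2)) ^ 3 / 6 := by
      have : (θ * (m / 2)) ^ 3 / 6 = θ * (m / 2) * ((θ * (m / 2)) ^ 2 / 6) := by ring
      rw [this]
      have : (θ * (m / 2)) ^ 2 / 6 ≤ 1 := by rw [div_le_one (by norm_num)]; exact hmθ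
      nlinarith
    linarith
  have hs2 : 0 ≤ Real.sin (θ / 2) := by
    have : θ / 2 - (θ / 2) ^ 3 / 6 ≥ 0 := by
      have hθ1 : θ ^ 2 ≤ 1 := hT.trans hT1
      nlinarith
    linarith
  have hθ2 : 0 < θ ^ 2 := by positivity
  constructor
  · rw [max_le_iff]
    constructor
    · positivity
    · -- lower: product of the two lower sine bounds
      rw [le_div_iff₀ hθ2]
      have hA : 0 ≤ θ * (m / 2) - (θ * (m / 2)) ^ 3 / 6 ∨ θ * (m / 2) - (θ * (m / 2)) ^ 3 / 6 < 0 := le_or_gt _ _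
      -- the raw lower bound equals `4·A·B/θ²·θ²` with A, B the cube bounds, up to the monotone replacements θ² ≤ T
      have hB0 : 0 ≤ θ / 2 - (θ / 2) ^ 3 / 6 := by
        have hθ1 : θ ^ 2 ≤ 1 := hT.trans hT1
        nlinarith
      have hprod : (θ * (m / 2) - (θ * (m / 2)) ^ 3 / 6) * (θ / 2 - (θ / 2) ^ 3 / 6)
          ≤ Real.sin (θ * (m / 2)) * Real.sin (θ / 2) := by
        rcases hA with hA0 | hAneg
        · exact mul_le_mul s1l s2l hB0 hs1
        · have : (θ * (m / 2) - (θ * (m / 2)) ^ 3 / 6) * (θ / 2 - (θ / 2) ^ 3 / 6) ≤ 0 :=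
            mul_nonpos_of_nonpos_of_nonneg hAneg.le hB0
          have := mul_nonneg hs1 hs2
          linarith
      -- compare the raw bound with the polynomial lower bound
      have hpoly : m * (1 - T * m ^ 2 / 24) * (1 - T / 24) * θ ^ 2
          ≤ 4 * ((θ * (m / 2) - (θ * (m / 2)) ^ 3 / 6) * (θ / 2 - (θ / 2) ^ 3 / 6)) := by
        -- 4·A·B = θ² · m (1 − θ²m²/24)(1 − θ²/24) and θ² ≤ T in both brackets (when the brackets are used with m ≥ 0)
        have e : 4 * ((θ * (m / 2) - (θ * (m / 2)) ^ 3 / 6) * (θ / 2 - (θ / 2) ^ 3 / 6))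
            = m * (1 - θ ^ 2 * m ^ 2 / 24) * (1 - θ ^ 2 / 24) * θ ^ 2 := by ring
        rw [e]
        apply mul_le_mul_of_nonneg_right _ hθ2.le
        -- case on the sign of (1 − T m²/24)
        by_cases hc : 0 ≤ 1 - T * m ^ 2 / 24
        · have h1 : 1 - T * m ^ 2 / 24 ≤ 1 - θ ^ 2 * m ^ 2 / 24 := by nlinarith [sq_nonneg m]
          have h2 : 1 - T / 24 ≤ 1 - θ ^ 2 / 24 := by linarith
          have h3 : 0 ≤ 1 - T / 24 := by linarith
          have h4 : 0 ≤ m * (1 - T * m ^ 2 / 24) := mul_nonneg hm hc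
          calc m * (1 - T * m ^ 2 / 24) * (1 - T / 24)
              ≤ m * (1 - θ ^ 2 * m ^ 2 / 24) * (1 - T / 24) := by
                apply mul_le_mul_of_nonneg_right _ h3
                exact mul_le_mul_of_nonneg_left h1 hm
            _ ≤ m * (1 - θ ^ 2 * m ^ 2 / 24) * (1 - θ ^ 2 / 24) := by
                apply mul_le_mul_of_nonneg_left h2
                exact le_trans h4 (mul_le_mul_of_nonneg_left h1 hm)
        · push Not at hc
          have h3 : 0 ≤ 1 - T / 24 := by linarith
          have hneg : m * (1 - T * m ^ 2 / 24) * (1 - T / 24) ≤ 0 :=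
            mul_nonpos_of_nonpos_of_nonneg (mul_nonpos_of_nonneg_of_nonpos hm hc.le) h3
          have hpos' : 0 ≤ m * (1 - θ ^ 2 * m ^ 2 / 24) * (1 - θ ^ 2 / 24) := by
            have hθ1 : θ ^ 2 ≤ 1 := hT.trans hT1
            have : 0 ≤ 1 - θ ^ 2 * m ^ 2 / 24 := by nlinarith
            have : 0 ≤ 1 - θ ^ 2 / 24 := by nlinarith
            positivity
          linarith
      linarith
  · -- upper
    rw [div_le_iff₀ hθ2]
    have := mul_le_mul s1u s2u hs2 hy0
    nlinarith

/-! ## Elementary pieces of the window majorant -/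

omit [NeZero L] in
/-- integer window bounds as a real absolute value bound. [folklore] -/
theorem abs_intCast_le_of_mem_zWindow (K : ℕ) (p : ℤ × ℤ) (hp : p ∈ zWindow K) :
    |((p.1 : ℤ) : ℝ)| ≤ K ∧ |((p.2 : ℤ) : ℝ)| ≤ K := by
  obtain ⟨_, ⟨ha, hb⟩, ⟨hc, hd⟩⟩ := (mem_zWindow_iff K p).1 hp
  have ha' : (-(K : ℤ) : ℝ) ≤ ((p.1 : ℤ) : ℝ) := by exact_mod_cast ha
  have hb' : ((p.1 : ℤ) : ℝ) ≤ ((K : ℤ) : ℝ) := by exact_mod_cast hb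
  have hc' : (-(K : ℤ) : ℝ) ≤ ((p.2 : ℤ) : ℝ) := by exact_mod_cast hc
  have hd' : ((p.2 : ℤ) : ℝ) ≤ ((K : ℤ) : ℝ) := by exact_mod_cast hd
  push_cast at ha' hb' hc' hd'
  exact ⟨abs_le.2 ⟨ha', hb'⟩, abs_le.2 ⟨hc', hd'⟩⟩

omit [NeZero L] in
/-- term A, case `d = D ≥ 0`: `e·G₋²·(1 − DG) ≤ Ghi₋²·max 0 (1 − dlo·Glo)`. [folklore] -/
theorem termA_pos_le (e Gm G D Ghim Glo dlo : ℝ) (he0 : 0 ≤ e) (he1 : e ≤ 1) (hGm0 : 0 ≤ Gm) (hGmhi : Gm ≤ Ghim)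
    (hGlo : Glo ≤ G) (hGlo0 : 0 ≤ Glo) (hD0 : 0 ≤ D) (hdlo : dlo ≤ D) :
    e * Gm ^ 2 * (1 - D * G) ≤ Ghim ^ 2 * max 0 (1 - dlo * Glo) := by
  have hmax0 : 0 ≤ max 0 (1 - dlo * Glo) := le_max_left _ _
  have hGm2 : Gm ^ 2 ≤ Ghim ^ 2 := pow_le_pow_left₀ hGm0 hGmhi 2
  by_cases hs : 0 ≤ 1 - D * G
  · have s1 : e * Gm ^ 2 * (1 - D * G) ≤ Gm ^ 2 * (1 - D * G) := by
      have h0 : 0 ≤ Gm ^ 2 * (1 - D * G) := mul_nonneg (sq_nonneg _) hs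
      nlinarith
    have s2 : Gm ^ 2 * (1 - D * G) ≤ Ghim ^ 2 * (1 - D * G) := mul_le_mul_of_nonneg_right hGm2 hs
    have s3 : 1 - D * G ≤ max 0 (1 - dlo * Glo) := by
      apply le_max_of_le_right
      have := mul_le_mul hdlo hGlo hGlo0 hD0
      linarith
    have s4 := mul_le_mul_of_nonneg_left s3 (sq_nonneg Ghim)
    linarith
  · push Not at hs
    have s1 : e * Gm ^ 2 * (1 - D * G) ≤ 0 := mul_nonpos_of_nonneg_of_nonpos (mul_nonneg he0 (sq_nonneg _)) hs.le
    have s2 : 0 ≤ Ghim ^ 2 * max 0 (1 - dlo * Glo) := mul_nonneg (sq_nonneg _) hmax0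
    linarith

omit [NeZero L] in
/-- term A, case `d = −D ≤ 0`: `e·G₋²·(1 + DG) ≤ Ghi₋²·(1 + m·Ghi)`. [folklore] -/
theorem termA_neg_le (e Gm G D Ghim Ghi m : ℝ) (he1 : e ≤ 1) (hGm0 : 0 ≤ Gm) (hGmhi : Gm ≤ Ghim)
    (hG0 : 0 ≤ G) (hGhi : G ≤ Ghi) (hD0 : 0 ≤ D) (hDhi : D ≤ m) (hm0 : 0 ≤ m) :
    e * Gm ^ 2 * (1 - -D * G) ≤ Ghim ^ 2 * (1 + m * Ghi) := by
  have hGm2 : Gm ^ 2 ≤ Ghim ^ 2 := pow_le_pow_left₀ hGm0 hGmhi 2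
  have hs : 0 ≤ 1 - -D * G := by nlinarith [mul_nonneg hD0 hG0]
  have s1 : e * Gm ^ 2 * (1 - -D * G) ≤ Gm ^ 2 * (1 - -D * G) := by
    have h0 : 0 ≤ Gm ^ 2 * (1 - -D * G) := mul_nonneg (sq_nonneg _) hs
    nlinarith
  have s2 : Gm ^ 2 * (1 - -D * G) ≤ Ghim ^ 2 * (1 - -D * G) := mul_le_mul_of_nonneg_right hGm2 hs
  have s3 : 1 - -D * G ≤ 1 + m * Ghi := by
    have := mul_le_mul hDhi hGhi hG0 hm0
    linarith
  have s4 := mul_le_mul_of_nonneg_left s3 (sq_nonneg Ghim)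
  linarith

omit [NeZero L] in
/-- term B, case `0 ≤ a_y^lo − ν₂`: `−d²(a_y − ν)G²G₋² ≤ −dlo²(a_y^lo − ν₂)Glo²Glo₋²`. [folklore] -/
theorem termB_pos_le (d2 dlo2 ayν aylν G2 Gm2 Glo2 Glom2 : ℝ) (hc : 0 ≤ aylν) (hay : aylν ≤ ayν) (hd : dlo2 ≤ d2)
    (hdlo0 : 0 ≤ dlo2) (hG : Glo2 ≤ G2) (hGlo0 : 0 ≤ Glo2) (hGm : Glom2 ≤ Gm2) (hGlom0 : 0 ≤ Glom2) :
    -(d2 * ayν * G2 * Gm2) ≤ -(dlo2 * aylν * Glo2 * Glom2) := by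
  have hayν0 : 0 ≤ ayν := le_trans hc hay
  have hd0 : 0 ≤ d2 := le_trans hdlo0 hd
  have t1 : dlo2 * aylν ≤ d2 * ayν := mul_le_mul hd hay hc hd0
  have t2 : dlo2 * aylν * Glo2 ≤ d2 * ayν * G2 := mul_le_mul t1 hG hGlo0 (mul_nonneg hd0 hayν0)
  have t3 : dlo2 * aylν * Glo2 * Glom2 ≤ d2 * ayν * G2 * Gm2 :=
    mul_le_mul t2 hGm hGlom0 (mul_nonneg (mul_nonneg hd0 hayν0) (le_trans hGlo0 hG))
  linarith

omit [NeZero L] in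
/-- term B, case `a_y^lo − ν₂ < 0`: `−d²(a_y − ν)G²G₋² ≤ m²(ν₂ − a_y^lo)Ghi²Ghi₋²`. [folklore] -/
theorem termB_neg_le (d2 m2 ayν aylν G2 Gm2 Ghi2 Ghim2 : ℝ) (hc : aylν < 0) (hay : aylν ≤ ayν) (hd : d2 ≤ m2)
    (hd0 : 0 ≤ d2) (hG : G2 ≤ Ghi2) (hG0 : 0 ≤ G2) (hGm : Gm2 ≤ Ghim2) (hGm0 : 0 ≤ Gm2) :
    -(d2 * ayν * G2 * Gm2) ≤ m2 * (-aylν) * Ghi2 * Ghim2 := by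
  have hm0 : 0 ≤ m2 := le_trans hd0 hd
  have hR0 : 0 ≤ m2 * (-aylν) * Ghi2 * Ghim2 := by
    have : 0 ≤ -aylν := by linarith
    exact mul_nonneg (mul_nonneg (mul_nonneg hm0 this) (le_trans hG0 hG)) (le_trans hGm0 hGm)
  by_cases hs : 0 ≤ ayν
  · have : 0 ≤ d2 * ayν * G2 * Gm2 := mul_nonneg (mul_nonneg (mul_nonneg hd0 hs) hG0) hGm0
    linarith
  · push Not at hs
    have hneg : -(d2 * ayν * G2 * Gm2) = d2 * (-ayν) * G2 * Gm2 := by ring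
    rw [hneg]
    have hνa : -ayν ≤ -aylν := by linarith
    have hνa0 : 0 ≤ -ayν := by linarith
    have t1 : d2 * (-ayν) ≤ m2 * (-aylν) := mul_le_mul hd hνa hνa0 hm0
    have t2 : d2 * (-ayν) * G2 ≤ m2 * (-aylν) * Ghi2 := mul_le_mul t1 hG hG0 (mul_nonneg hm0 (by linarith))
    exact mul_le_mul t2 hGm hGm0 (mul_nonneg (mul_nonneg hm0 (by linarith)) (le_trans hG0 hG))

end RowC

end Summit.HubbardSuperconductivity.HubbardSuperconductivity.Theorems.AnisotropyChord.Transfer.Fibre3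

end
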